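import Mathlib
import Summits.KontsevichZagierPeriods.Zeta5Search.Certificates.RecordRayDecay
import Summits.KontsevichZagierPeriods.Zeta5Search.Certificates.RecordRayGrowth
import Summits.KontsevichZagierPeriods.Zeta5Search.Certificates.RecordRayDenominatorsBricksD16Tail
import HarnessLib

/-!
# `theorem1'` from ONE named hypothesis pair: (E) and (N ∀ᶠ) on the record ray
(fam-tele g17; assembly glue, hypotheses-parametric — it proves no certificate)

HONEST FRAMING: systematic search; no irrationality claim unless certified.  This file pins down, as a checked
implication, exactly what separates the tree from the literal statement `BrownZudilin2022.theorem1'` (Brown–Zudilin's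
own Theorem 1 at its printed exponent `0.86`; `0.86 < 1`, NO irrationality content, NO number in print moves):

* `tendsto_recordP_div_recordQ` — the LIMIT clause `P_n/Q_n → ζ(5)`, unconditionally, from the tree's decay of the
  record forms (`eventually_recordForm_le_exp`: `|Q_nζ(5) − P_n| ≤ e^{(−31.5452+ε)n}`) and `|Q_n| ≥ 1` (`abs_recordQ_pos`);
* `theorem1'_of_eventually_ne` — `theorem1'` with the witnesses `p n = P_n`, `q n = Q_n`, GIVEN
  (E) `IsAperyType recordP (fun n => (recordQ n : ℚ))` (the Apéry-type recursion; fam-tele file #9 `aperyType_recordPQ`,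
  held for cert-1's read) and (N ∀ᶠ) `∀ᶠ n, recordForm n ≠ 0` (non-vanishing for all large `n`; NOT in the tree — the
  tree has (N ∃ᶠ) via `RecordRayWindow`, and `RecordRayConeN.recordForm_eventually_ne_zero_of_cone` reduces (N ∀ᶠ) to two
  cone certificates).  The METRIC clause is the tree's hypothesis-free (M) `record_exponent_bricksD16_tail` at
  `γ = 0.86 ≤ 0.8603`, transported to the REDUCED denominator `(P_n/Q_n).den ≤ q_n = MLT·|Q_n|` (`den ∣ q_n`).

Nothing here is new mathematics; how a landed instance may be worded relative to [BrownZudilin2022, Theorem 1] is the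
referees' call.
-/

namespace Summit.KontsevichZagierPeriods.Zeta5Search.RecordRay.Generic

open Filter Topology
open Literature.NumberTheory.Transcendental (zetaValue)
open Literature.NumberTheory.Irrationality.BrownZudilin2022 (IsAperyType theorem1')
open Summit.KontsevichZagierPeriods.Zeta5Search.RecordRay.BrickAtlas (MLT bwinsD16 record_exponent_bricksD16_tail)

/-- Cast bookkeeping: `((P_n / Q_n : ℚ) : ℝ) = P_n / Q_n` in `ℝ`. -/
theorem ratCast_recordP_div (n : ℕ) :
    ((recordP n / (recordQ n : ℚ) : ℚ) : ℝ) = (recordP n : ℝ) / (recordQ n : ℝ) := by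
  push_cast
  rfl

/-- `Q_n ≠ 0` for every `n` (from `abs_recordQ_pos`). -/
theorem recordQ_ne_zero (n : ℕ) : recordQ n ≠ 0 := by
  intro h
  have := abs_recordQ_pos n
  rw [h] at this
  simp at this

/-- `P_n/Q_n = ζ(5) − L_n/Q_n` with `L_n = recordForm n = Q_nζ(5) − P_n` (`n ≥ 1`). -/
theorem recordP_div_recordQ_eq {n : ℕ} (hn : 1 ≤ n) :
    (recordP n : ℝ) / (recordQ n : ℝ) = zetaValue 5 - recordForm n / (recordQ n : ℝ) := by
  have hQR : (recordQ n : ℝ) ≠ 0 := by exact_mod_cast recordQ_ne_zero n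
  rw [recordForm_eq hn, sub_div, mul_div_cancel_left₀ _ hQR, sub_sub_cancel]

/-- **LIMIT clause (unconditional).**  `P_n/Q_n → ζ(5)`. -/
theorem tendsto_recordP_div_recordQ :
    Tendsto (fun n => ((recordP n / (recordQ n : ℚ) : ℚ) : ℝ)) atTop (𝓝 (zetaValue 5)) := by
  rw [tendsto_iff_norm_sub_tendsto_zero]
  refine squeeze_zero' (g := fun n : ℕ => Real.exp ((-315452 / 10000 + 1) * (n : ℝ)))
    (Eventually.of_forall fun n => norm_nonneg _) ?_ ?_
  · filter_upwards [eventually_ge_atTop 1, eventually_recordForm_le_exp one_pos] with n hn hL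
    have h1 : (1 : ℝ) ≤ |(recordQ n : ℝ)| := by
      rw [← Int.cast_abs]; exact_mod_cast Int.one_le_abs (recordQ_ne_zero n)
    rw [Real.norm_eq_abs, ratCast_recordP_div, recordP_div_recordQ_eq hn, sub_sub_cancel_left, abs_neg, abs_div]
    exact (div_le_self (abs_nonneg _) h1).trans hL
  · have hc : (-315452 / 10000 + 1 : ℝ) < 0 := by norm_num
    exact Real.tendsto_exp_atBot.comp (tendsto_natCast_atTop_atTop.const_mul_atTop_of_neg hc)

/-- The reduced denominator of `P_n/Q_n` divides the (M)-clause denominator `q = MLT·|Q_n|` whenever `p = MLT·P_n` is an integer. -/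
theorem den_recordP_div_le {n : ℕ} {p : ℤ} {q : ℕ} (hq : 1 ≤ q) (hqQ : (q : ℚ) = MLT bwinsD16 n * |(recordQ n : ℚ)|)
    (hpP : (p : ℚ) = MLT bwinsD16 n * recordP n) : (recordP n / (recordQ n : ℚ)).den ≤ q := by
  have hQQ : ((recordQ n : ℤ) : ℚ) ≠ 0 := by exact_mod_cast recordQ_ne_zero n
  have hq0 : (q : ℚ) ≠ 0 := by exact_mod_cast (by omega : q ≠ 0)
  obtain ⟨Z, hZ⟩ : ∃ Z : ℤ, recordP n / (recordQ n : ℚ) = (Z : ℚ) / (q : ℚ) := by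
    rcases abs_choice ((recordQ n : ℚ)) with habs | habs
    · exact ⟨p, by rw [div_eq_div_iff hQQ hq0, hpP, hqQ, habs]; ring⟩
    · exact ⟨-p, by rw [div_eq_div_iff hQQ hq0, Int.cast_neg, hpP, hqQ, habs]; ring⟩
  have hdvd : (recordP n / (recordQ n : ℚ)).den ∣ q := by
    rw [hZ]
    have h := Rat.den_dvd Z q
    rw [Rat.divInt_eq_div] at h
    push_cast at h
    exact Int.natCast_dvd_natCast.1 h
  exact Nat.le_of_dvd (by omega) hdvd

/-- **`theorem1'` from (E) and (N ∀ᶠ) on the record ray.**  Witnesses `p n = P_n`, `q n = Q_n`; the limit clause is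
`tendsto_recordP_div_recordQ`, the metric clause is the tree's (M) `record_exponent_bricksD16_tail` at `γ = 0.86`
moved to the reduced denominator.  HONEST FRAMING: `0.86 < 1`; an implication between named statements, no
irrationality content; the hypothesis (N ∀ᶠ) is NOT in the tree. -/
theorem theorem1'_of_eventually_ne (hE : IsAperyType recordP fun n => (recordQ n : ℚ))
    (hN : ∀ᶠ n : ℕ in atTop, recordForm n ≠ 0) : theorem1' := by
  refine ⟨recordP, fun n => (recordQ n : ℚ), hE, tendsto_recordP_div_recordQ, ?_⟩
  show ∀ᶠ n : ℕ in atTop, (recordQ n : ℚ) ≠ 0 ∧ 0 < |zetaValue 5 - ((recordP n / (recordQ n : ℚ) : ℚ) : ℝ)| ∧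
    |zetaValue 5 - ((recordP n / (recordQ n : ℚ) : ℚ) : ℝ)| < 1 / ((recordP n / (recordQ n : ℚ)).den : ℝ) ^ (0.86 : ℝ)
  filter_upwards [eventually_ge_atTop 1, hN,
    record_exponent_bricksD16_tail (γ := (0.86 : ℝ)) (by norm_num) (by norm_num)] with n hn hL hM
  obtain ⟨p, q, hq, hqQ, hpP, hlt⟩ := hM
  have hQR : (recordQ n : ℝ) ≠ 0 := by exact_mod_cast recordQ_ne_zero n
  refine ⟨by exact_mod_cast recordQ_ne_zero n, ?_, ?_⟩
  · rw [ratCast_recordP_div, recordP_div_recordQ_eq hn, sub_sub_cancel, abs_pos]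
    exact div_ne_zero hL hQR
  · rw [ratCast_recordP_div]
    refine hlt.trans_le ?_
    have hden : ((recordP n / (recordQ n : ℚ)).den : ℝ) ≤ q := by exact_mod_cast den_recordP_div_le hq hqQ hpP
    have hden0 : (0 : ℝ) < ((recordP n / (recordQ n : ℚ)).den : ℝ) := by exact_mod_cast Rat.den_pos _
    exact one_div_le_one_div_of_le (Real.rpow_pos_of_pos hden0 _)
      (Real.rpow_le_rpow hden0.le hden (by norm_num))

end Summit.KontsevichZagierPeriods.Zeta5Search.RecordRay.Generic
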